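import Mathlib.Algebra.CharP.Lemmas
import Mathlib.Algebra.CharP.Frobenius
import Mathlib.Algebra.Module.RingHom
import Literature.NumberTheory.GaloisCohomology.KatoCohomologyDifferentialForms
import HarnessLib

/-!
# Frobenius-twisted de Rham cohomology of a ring of characteristic `p`, and wedging with `b^{p-1} db`

Infrastructure for the inverse Cartier operator (`InverseCartierOperator.lean`).  For a commutative ring
`K` of prime characteristic `p` and its absolute de Rham complex `(Ωⁿ_K = ⋀ⁿ_K Ω[K⁄ℤ], d)`
(`Crystalline/KaehlerDeRhamComplex`):

* `FrobeniusTwist p K M` — a `K`-module `M` with its scalar action twisted by Frobenius, `c • m := c^p • m`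
  (`Module.compHom` along `frobenius K p`).  A `K`-linear map `N → FrobeniusTwist p K M` from an ordinary
  `K`-module `N` is exactly a `p`-SEMILINEAR map `N → M`.
* `closedTwist p K n`, `exactTwist p K n` — the closed forms `Zⁿ = ker d` and the exact forms `Bⁿ = im d` as
  `K`-SUBMODULES of `FrobeniusTwist p K Ωⁿ_K` (they are stable under `c^p •` because `d (c^p ω) = c^p dω`:
  `D (c^p) = p c^{p-1} D c = 0`), and the twisted de Rham cohomology `deRhamH p K n = Zⁿ/Bⁿ`, a `K`-module.
* `wedgeH θ hθ n : deRhamH p K n →ₗ[K] deRhamH p K (n+1)`, `[ω] ↦ [θ ∧ ω]` for a CLOSED one-form `θ`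
  (well defined: `θ ∧ dη = -d(θ ∧ η)`), with `wedgeH θ ∘ wedgeH θ = 0`, `wedgeH θ ∘ wedgeH θ' = -wedgeH θ' ∘ wedgeH θ`,
  additivity in `θ`, and `wedgeH (ds) = 0` (`ds ∧ ω = d(s ω)` for closed `ω`).
* `cartierForm p K b = b^{p-1} • D b` — the closed one-form `"d(b^p)/p"`, with
  `cartierForm (ab) = a^p • cartierForm b + b^p • cartierForm a`.

The derivation `b ↦ wedgeH (cartierForm b)` and the operator itself are assembled in `InverseCartierOperator`
(it needs the additivity `cartierForm (a+b) − cartierForm a − cartierForm b = d S_p(a,b)`,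
file `AddPowDerivation`).  Everything here is proved; no named fact.

## References

* P. Gille, T. Szamuely, *Central simple algebras and Galois cohomology*, 2nd ed., CUP 2017, §9.2
  (Lemma 9.2.1: the inverse Cartier operator), §9.4. [GilleSzamuely2017]
* L. Illusie, *Complexe de de Rham–Witt et cohomologie cristalline*, Ann. Sci. ÉNS 12 (1979), 0.(2.1)
  (Cartier isomorphism). [Illusie1979]
-/

noncomputable section

open KaehlerDifferential (D)
open ExteriorAlgebra (ι)
open Literature.AlgebraicGeometry.Crystalline (ιMul coe_ιMul)
open Literature.AlgebraicGeometry.Crystalline.KaehlerExteriorDerivative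
  (kaehlerExteriorDerivative extD coe_kaehlerExteriorDerivative kaehlerExteriorDerivative_smul
    kaehlerExteriorDerivative_kaehlerExteriorDerivative extD_ι_D extD_mul extD_ι_smul_D)

namespace Literature.NumberTheory.GaloisCohomology

universe u v

/-! ### The Frobenius twist of a module -/

section Twist

variable (p : ℕ) (K : Type u) [CommRing K] [ExpChar K p] (M : Type v) [AddCommGroup M] [Module K M]

/-- **The Frobenius twist** of a `K`-module `M` (`K` of exponential characteristic `p`): the additive group
`M` with the scalar action `c • m := c^p • m`.  `K`-linear maps into it are `p`-semilinear maps into `M`.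
[folklore] -/
@[nolint unusedArguments]
def FrobeniusTwist (_p : ℕ) (_K : Type u) (M : Type v) : Type v := M

namespace FrobeniusTwist

/-- The additive group structure of the twist is that of `M`. [folklore] -/
instance : AddCommGroup (FrobeniusTwist p K M) := inferInstanceAs (AddCommGroup M)

/-- The twisted action `c • m := c^p • m` (`Module.compHom` along the Frobenius ring map). [folklore] -/
instance : Module K (FrobeniusTwist p K M) := Module.compHom M (frobenius K p)

variable {M}

/-- The identity `M ≃+ FrobeniusTwist p K M`. [folklore] -/
def of : M ≃+ FrobeniusTwist p K M := AddEquiv.refl M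

/-- The twisted action in terms of the original one: `c • of m = of (c^p • m)`. [folklore] -/
theorem smul_of (c : K) (m : M) : c • of p K m = of p K (c ^ p • m) := rfl

/-- The twisted action in terms of the original one. [folklore] -/
theorem of_symm_smul (c : K) (x : FrobeniusTwist p K M) : (of p K).symm (c • x) = c ^ p • (of p K).symm x :=
  rfl

end FrobeniusTwist

end Twist

/-! ### Closed and exact forms, twisted de Rham cohomology -/

section DeRham

variable (p : ℕ) [hp : Fact p.Prime] (K : Type u) [CommRing K] [CharP K p]

omit hp in
/-- `D (c^p) = 0` in characteristic `p`. [folklore] -/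
theorem D_pow_char (c : K) : D ℤ K (c ^ p) = 0 := by
  rw [(D ℤ K).leibniz_pow, ← Nat.cast_smul_eq_nsmul K, CharP.cast_eq_zero, zero_smul]

omit hp in
/-- `d (c^p • ω) = c^p • d ω`: the exterior derivative is linear over `p`-th powers. [folklore] -/
theorem kaehlerExteriorDerivative_pow_char_smul (n : ℕ) (c : K) (ω : ⋀[K]^n (Ω[K⁄ℤ])) :
    kaehlerExteriorDerivative ℤ K n (c ^ p • ω) = c ^ p • kaehlerExteriorDerivative ℤ K n ω := by
  rw [kaehlerExteriorDerivative_smul, D_pow_char, add_eq_right]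
  exact Subtype.ext (by rw [coe_ιMul, map_zero, zero_mul, Submodule.coe_zero])

/-- **Closed `n`-forms `Zⁿ = ker d`**, as a `K`-submodule of the Frobenius twist of `Ωⁿ_K` (stable under
`c^p •`). [folklore] -/
def closedTwist (n : ℕ) : Submodule K (FrobeniusTwist p K (⋀[K]^n (Ω[K⁄ℤ]))) where
  carrier := {x | kaehlerExteriorDerivative ℤ K n ((FrobeniusTwist.of p K).symm x) = 0}
  zero_mem' := by simp only [Set.mem_setOf_eq, map_zero]
  add_mem' {x y} hx hy := by
    simp only [Set.mem_setOf_eq, map_add] at hx hy ⊢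
    rw [hx, hy, add_zero]
  smul_mem' c x hx := by
    simp only [Set.mem_setOf_eq] at hx ⊢
    rw [FrobeniusTwist.of_symm_smul, kaehlerExteriorDerivative_pow_char_smul, hx, smul_zero]

/-- Membership in `closedTwist`. [folklore] -/
theorem mem_closedTwist_iff (n : ℕ) (x : FrobeniusTwist p K (⋀[K]^n (Ω[K⁄ℤ]))) :
    x ∈ closedTwist p K n ↔ kaehlerExteriorDerivative ℤ K n ((FrobeniusTwist.of p K).symm x) = 0 :=
  Iff.rfl

/-- **Exact `n`-forms `Bⁿ = im d`** (`⊥` for `n = 0`), as a `K`-submodule of the Frobenius twist of `Ωⁿ_K`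
(`c^p • dη = d(c^p • η)`). [folklore] -/
def exactTwist (n : ℕ) : Submodule K (FrobeniusTwist p K (⋀[K]^n (Ω[K⁄ℤ]))) where
  carrier := {x | (FrobeniusTwist.of p K).symm x ∈ exactForms K n}
  zero_mem' := by simp only [Set.mem_setOf_eq, map_zero]; exact AddSubgroup.zero_mem _
  add_mem' {x y} hx hy := by
    simp only [Set.mem_setOf_eq, map_add] at hx hy ⊢
    exact AddSubgroup.add_mem _ hx hy
  smul_mem' c x hx := by
    simp only [Set.mem_setOf_eq] at hx ⊢
    rw [FrobeniusTwist.of_symm_smul]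
    cases n with
    | zero =>
      rw [exactForms_zero, AddSubgroup.mem_bot] at hx ⊢
      rw [hx, smul_zero]
    | succ m =>
      obtain ⟨η, hη⟩ := (mem_exactForms_succ_iff K m _).1 hx
      exact (mem_exactForms_succ_iff K m _).2 ⟨c ^ p • η, by rw [kaehlerExteriorDerivative_pow_char_smul, hη]⟩

/-- Membership in `exactTwist`. [folklore] -/
theorem mem_exactTwist_iff (n : ℕ) (x : FrobeniusTwist p K (⋀[K]^n (Ω[K⁄ℤ]))) :
    x ∈ exactTwist p K n ↔ (FrobeniusTwist.of p K).symm x ∈ exactForms K n :=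
  Iff.rfl

/-- Exact forms are closed (`d ∘ d = 0`). [folklore] -/
theorem exactTwist_le_closedTwist (n : ℕ) : exactTwist p K n ≤ closedTwist p K n := by
  intro x hx
  rw [mem_closedTwist_iff]
  cases n with
  | zero =>
    rw [mem_exactTwist_iff, exactForms_zero, AddSubgroup.mem_bot] at hx
    rw [hx, map_zero]
  | succ m =>
    obtain ⟨η, hη⟩ := (mem_exactForms_succ_iff K m ((FrobeniusTwist.of p K).symm x)).1 hx
    rw [← hη, kaehlerExteriorDerivative_kaehlerExteriorDerivative]

/-- **The (Frobenius-twisted) de Rham cohomology `Hⁿ_dR(K/ℤ) = Zⁿ/Bⁿ`** of `K`, a `K`-module with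
`c • [ω] = [c^p ω]`. [folklore] -/
abbrev deRhamH (n : ℕ) : Type u :=
  ↥(closedTwist p K n) ⧸ (exactTwist p K n).comap (closedTwist p K n).subtype

variable {p K}

/-- The class `[ω] ∈ Hⁿ` of a closed `n`-form `ω`. [folklore] -/
def deRhamH.cls {n : ℕ} (ω : ⋀[K]^n (Ω[K⁄ℤ])) (hω : kaehlerExteriorDerivative ℤ K n ω = 0) : deRhamH p K n :=
  Submodule.Quotient.mk ⟨FrobeniusTwist.of p K ω, hω⟩

/-- The class of an exact form is zero. [folklore] -/
theorem deRhamH.cls_eq_zero_of_mem_exactForms {n : ℕ} (ω : ⋀[K]^n (Ω[K⁄ℤ]))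
    (hω : kaehlerExteriorDerivative ℤ K n ω = 0) (hex : ω ∈ exactForms K n) :
    deRhamH.cls (p := p) ω hω = 0 :=
  (Submodule.Quotient.mk_eq_zero _).2 hex

/-- Two closed forms differing by an exact form have the same class. [folklore] -/
theorem deRhamH.cls_eq_cls_of_sub_mem {n : ℕ} (ω ω' : ⋀[K]^n (Ω[K⁄ℤ]))
    (hω : kaehlerExteriorDerivative ℤ K n ω = 0) (hω' : kaehlerExteriorDerivative ℤ K n ω' = 0)
    (h : ω - ω' ∈ exactForms K n) : deRhamH.cls (p := p) ω hω = deRhamH.cls ω' hω' :=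
  (Submodule.Quotient.eq _).2 h

/-- `[ω] + [ω'] = [ω + ω']`. [folklore] -/
theorem deRhamH.cls_add_cls {n : ℕ} (ω ω' : ⋀[K]^n (Ω[K⁄ℤ]))
    (hω : kaehlerExteriorDerivative ℤ K n ω = 0) (hω' : kaehlerExteriorDerivative ℤ K n ω' = 0) :
    deRhamH.cls (p := p) ω hω + deRhamH.cls ω' hω' =
      deRhamH.cls (ω + ω') (by rw [map_add, hω, hω', add_zero]) :=
  rfl

/-- Classes of equal forms are equal (proof-irrelevance helper). [folklore] -/
theorem deRhamH.cls_congr {n : ℕ} {ω ω' : ⋀[K]^n (Ω[K⁄ℤ])} (h : ω = ω')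
    (hω : kaehlerExteriorDerivative ℤ K n ω = 0) (hω' : kaehlerExteriorDerivative ℤ K n ω' = 0) :
    deRhamH.cls (p := p) ω hω = deRhamH.cls ω' hω' := by
  subst h
  rfl

/-- `c • [ω] = [c^p • ω]`. [folklore] -/
theorem deRhamH.smul_cls {n : ℕ} (c : K) (ω : ⋀[K]^n (Ω[K⁄ℤ])) (hω : kaehlerExteriorDerivative ℤ K n ω = 0) :
    c • deRhamH.cls (p := p) ω hω =
      deRhamH.cls (c ^ p • ω) (by rw [kaehlerExteriorDerivative_pow_char_smul, hω, smul_zero]) :=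
  rfl

/-- Every class is the class of a closed form. [folklore] -/
theorem deRhamH.cls_surjective {n : ℕ} (x : deRhamH p K n) :
    ∃ (ω : ⋀[K]^n (Ω[K⁄ℤ])) (hω : kaehlerExteriorDerivative ℤ K n ω = 0), deRhamH.cls ω hω = x := by
  obtain ⟨⟨ω, hω⟩, rfl⟩ := Submodule.Quotient.mk_surjective _ x
  exact ⟨(FrobeniusTwist.of p K).symm ω, hω, rfl⟩

end DeRham

/-! ### Wedging with a closed one-form -/

section Wedge

variable {p : ℕ} [hp : Fact p.Prime] {K : Type u} [CommRing K] [CharP K p]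

/-- `ιMul` is additive in the one-form. [folklore] -/
theorem ιMul_add_left (n : ℕ) (θ θ' : Ω[K⁄ℤ]) (ω : ⋀[K]^n (Ω[K⁄ℤ])) :
    ιMul n (θ + θ') ω = ιMul n θ ω + ιMul n θ' ω :=
  Subtype.ext (by rw [Submodule.coe_add, coe_ιMul, coe_ιMul, coe_ιMul, map_add, add_mul])

/-- `ιMul` is homogeneous in the one-form. [folklore] -/
theorem ιMul_smul_left (n : ℕ) (c : K) (θ : Ω[K⁄ℤ]) (ω : ⋀[K]^n (Ω[K⁄ℤ])) :
    ιMul n (c • θ) ω = c • ιMul n θ ω :=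
  Subtype.ext (by rw [Submodule.coe_smul, coe_ιMul, coe_ιMul, map_smul, smul_mul_assoc])

/-- `θ ∧ θ ∧ ω = 0`. [folklore] -/
theorem ιMul_ιMul_self (n : ℕ) (θ : Ω[K⁄ℤ]) (ω : ⋀[K]^n (Ω[K⁄ℤ])) : ιMul (n + 1) θ (ιMul n θ ω) = 0 :=
  Subtype.ext (by rw [coe_ιMul, coe_ιMul, ← mul_assoc, ExteriorAlgebra.ι_sq_zero, zero_mul, Submodule.coe_zero])

/-- `θ ∧ θ' ∧ ω + θ' ∧ θ ∧ ω = 0`. [folklore] -/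
theorem ιMul_ιMul_add_swap (n : ℕ) (θ θ' : Ω[K⁄ℤ]) (ω : ⋀[K]^n (Ω[K⁄ℤ])) :
    ιMul (n + 1) θ (ιMul n θ' ω) + ιMul (n + 1) θ' (ιMul n θ ω) = 0 := by
  apply Subtype.ext
  rw [Submodule.coe_add, coe_ιMul, coe_ιMul, coe_ιMul, coe_ιMul, ← mul_assoc, ← mul_assoc, ← add_mul,
    Submodule.coe_zero]
  have h := ExteriorAlgebra.ι_sq_zero (R := K) (θ + θ')
  rw [map_add, add_mul, mul_add, mul_add, ExteriorAlgebra.ι_sq_zero, ExteriorAlgebra.ι_sq_zero, zero_add,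
    add_zero] at h
  rw [h, zero_mul]

/-- For a closed one-form `θ` and a closed form `ω`, `θ ∧ ω` is closed. [folklore] -/
theorem kaehlerExteriorDerivative_ιMul_of_closed (n : ℕ) {θ : Ω[K⁄ℤ]} (hθ : extD ℤ K (ι K θ) = 0)
    {ω : ⋀[K]^n (Ω[K⁄ℤ])} (hω : kaehlerExteriorDerivative ℤ K n ω = 0) :
    kaehlerExteriorDerivative ℤ K (n + 1) (ιMul n θ ω) = 0 := by
  apply Subtype.ext
  have hω' : extD ℤ K (ω : ExteriorAlgebra K (Ω[K⁄ℤ])) = 0 := by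
    rw [← coe_kaehlerExteriorDerivative, hω, Submodule.coe_zero]
  rw [coe_kaehlerExteriorDerivative, coe_ιMul, extD_mul, hθ, zero_mul, zero_add, hω', mul_zero,
    Submodule.coe_zero]

/-- For a closed one-form `θ`: `θ ∧ dη = -d(θ ∧ η)`. [folklore] -/
theorem ιMul_kaehlerExteriorDerivative_of_closed (m : ℕ) {θ : Ω[K⁄ℤ]} (hθ : extD ℤ K (ι K θ) = 0)
    (η : ⋀[K]^m (Ω[K⁄ℤ])) :
    ιMul (m + 1) θ (kaehlerExteriorDerivative ℤ K m η) = -kaehlerExteriorDerivative ℤ K (m + 1) (ιMul m θ η) := by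
  apply Subtype.ext
  rw [coe_ιMul, coe_kaehlerExteriorDerivative, Submodule.coe_neg, coe_kaehlerExteriorDerivative, coe_ιMul,
    extD_mul, hθ, zero_mul, zero_add, CliffordAlgebra.involute_ι, neg_mul, neg_neg]

variable (p)

/-- Wedging with a closed one-form on closed forms, `Zⁿ → Zⁿ⁺¹`, as a `K`-linear map of the twisted
modules. [folklore] -/
def wedgeClosed (θ : Ω[K⁄ℤ]) (hθ : extD ℤ K (ι K θ) = 0) (n : ℕ) :
    ↥(closedTwist p K n) →ₗ[K] ↥(closedTwist p K (n + 1)) where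
  toFun x := ⟨FrobeniusTwist.of p K (ιMul n θ ((FrobeniusTwist.of p K).symm x.1)),
    kaehlerExteriorDerivative_ιMul_of_closed n hθ x.2⟩
  map_add' x y := by
    apply Subtype.ext
    simp only [Submodule.coe_add, map_add]
  map_smul' c x := by
    apply Subtype.ext
    simp only [Submodule.coe_smul, RingHom.id_apply, FrobeniusTwist.smul_of, FrobeniusTwist.of_symm_smul,
      map_smul]

/-- **Wedging with a closed one-form `θ` on twisted de Rham cohomology**, `[ω] ↦ [θ ∧ ω]`
(`θ ∧ dη = -d(θ ∧ η)` makes it well defined). [folklore] -/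
def wedgeH (θ : Ω[K⁄ℤ]) (hθ : extD ℤ K (ι K θ) = 0) (n : ℕ) : deRhamH p K n →ₗ[K] deRhamH p K (n + 1) :=
  Submodule.mapQ _ _ (wedgeClosed p θ hθ n) (by
    intro x hx
    simp only [Submodule.mem_comap, Submodule.subtype_apply, mem_exactTwist_iff] at hx ⊢
    change ιMul n θ ((FrobeniusTwist.of p K).symm x.1) ∈ exactForms K (n + 1)
    cases n with
    | zero =>
      rw [exactForms_zero, AddSubgroup.mem_bot] at hx
      rw [hx, map_zero]
      exact AddSubgroup.zero_mem _
    | succ m =>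
      obtain ⟨η, hη⟩ := (mem_exactForms_succ_iff K m ((FrobeniusTwist.of p K).symm x.1)).1 hx
      refine (mem_exactForms_succ_iff K (m + 1) _).2 ⟨-ιMul m θ η, ?_⟩
      rw [map_neg, ← ιMul_kaehlerExteriorDerivative_of_closed m hθ η, hη])

/-- `wedgeH θ [ω] = [θ ∧ ω]`. [folklore] -/
theorem wedgeH_cls (θ : Ω[K⁄ℤ]) (hθ : extD ℤ K (ι K θ) = 0) {n : ℕ} (ω : ⋀[K]^n (Ω[K⁄ℤ]))
    (hω : kaehlerExteriorDerivative ℤ K n ω = 0) :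
    wedgeH p θ hθ n (deRhamH.cls ω hω) =
      deRhamH.cls (ιMul n θ ω) (kaehlerExteriorDerivative_ιMul_of_closed n hθ hω) :=
  rfl

/-- Extensionality on classes for linear maps out of `Hⁿ`. [folklore] -/
theorem deRhamH.hom_ext {n : ℕ} {N : Type v} [AddCommGroup N] [Module K N] {f g : deRhamH p K n →ₗ[K] N}
    (h : ∀ (ω : ⋀[K]^n (Ω[K⁄ℤ])) (hω : kaehlerExteriorDerivative ℤ K n ω = 0),
      f (deRhamH.cls ω hω) = g (deRhamH.cls ω hω)) : f = g := by
  apply LinearMap.ext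
  intro x
  obtain ⟨ω, hω, rfl⟩ := deRhamH.cls_surjective x
  exact h ω hω

/-- `wedgeH θ ∘ wedgeH θ = 0` (`θ ∧ θ = 0`). [folklore] -/
theorem wedgeH_comp_wedgeH_self (θ : Ω[K⁄ℤ]) (hθ : extD ℤ K (ι K θ) = 0) (n : ℕ) :
    (wedgeH p θ hθ (n + 1)).comp (wedgeH p θ hθ n) = 0 :=
  deRhamH.hom_ext p fun ω hω => by
    rw [LinearMap.comp_apply, wedgeH_cls, wedgeH_cls, LinearMap.zero_apply,
      deRhamH.cls_congr (ιMul_ιMul_self n θ ω) _ (map_zero _)]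
    exact deRhamH.cls_eq_zero_of_mem_exactForms _ _ (AddSubgroup.zero_mem _)

/-- `wedgeH θ ∘ wedgeH θ' + wedgeH θ' ∘ wedgeH θ = 0` (anticommutativity of one-forms). [folklore] -/
theorem wedgeH_comp_wedgeH_add (θ θ' : Ω[K⁄ℤ]) (hθ : extD ℤ K (ι K θ) = 0) (hθ' : extD ℤ K (ι K θ') = 0)
    (n : ℕ) :
    (wedgeH p θ hθ (n + 1)).comp (wedgeH p θ' hθ' n) + (wedgeH p θ' hθ' (n + 1)).comp (wedgeH p θ hθ n) = 0 :=
  deRhamH.hom_ext p fun ω hω => by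
    have h0 : ιMul (n + 1) θ (ιMul n θ' ω) + ιMul (n + 1) θ' (ιMul n θ ω) = 0 := ιMul_ιMul_add_swap n θ θ' ω
    have h1 : wedgeH p θ hθ (n + 1) (wedgeH p θ' hθ' n (deRhamH.cls ω hω)) +
        wedgeH p θ' hθ' (n + 1) (wedgeH p θ hθ n (deRhamH.cls ω hω)) = 0 := by
      rw [wedgeH_cls, wedgeH_cls, wedgeH_cls, wedgeH_cls, deRhamH.cls_add_cls, deRhamH.cls_congr h0 _ (map_zero _)]
      exact deRhamH.cls_eq_zero_of_mem_exactForms _ _ (AddSubgroup.zero_mem _)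
    simpa only [LinearMap.add_apply, LinearMap.comp_apply, LinearMap.zero_apply] using h1

/-- Additivity of `wedgeH` in the closed one-form. [folklore] -/
theorem wedgeH_add (θ θ' : Ω[K⁄ℤ]) (hθ : extD ℤ K (ι K θ) = 0) (hθ' : extD ℤ K (ι K θ') = 0) (n : ℕ) :
    wedgeH p (θ + θ') (by rw [map_add, map_add, hθ, hθ', add_zero]) n = wedgeH p θ hθ n + wedgeH p θ' hθ' n :=
  deRhamH.hom_ext p fun ω hω => by
    rw [LinearMap.add_apply, wedgeH_cls, wedgeH_cls, wedgeH_cls, deRhamH.cls_add_cls]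
    exact deRhamH.cls_congr (ιMul_add_left n θ θ' ω) _ _

/-- Homogeneity of `wedgeH` in the closed one-form under `p`-th powers: `wedgeH (c^p • θ) = c • wedgeH θ`
(the twisted action). [folklore] -/
theorem wedgeH_pow_smul (c : K) (θ : Ω[K⁄ℤ]) (hθ : extD ℤ K (ι K θ) = 0) (n : ℕ)
    (hcθ : extD ℤ K (ι K (c ^ p • θ)) = 0) :
    wedgeH p (c ^ p • θ) hcθ n = c • wedgeH p θ hθ n :=
  deRhamH.hom_ext p fun ω hω => by
    rw [LinearMap.smul_apply, wedgeH_cls, wedgeH_cls, deRhamH.smul_cls]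
    congr 1
    exact ιMul_smul_left n (c ^ p) θ ω

/-- `wedgeH (ds) = 0`: `ds ∧ ω = d(s ω)` for closed `ω`. [folklore] -/
theorem wedgeH_D_eq_zero (s : K) (n : ℕ) :
    wedgeH p (D ℤ K s) (extD_ι_D ℤ K s) n = 0 :=
  deRhamH.hom_ext p fun ω hω => by
    rw [wedgeH_cls, LinearMap.zero_apply]
    refine deRhamH.cls_eq_zero_of_mem_exactForms _ _ ((mem_exactForms_succ_iff K n _).2 ⟨s • ω, ?_⟩)
    rw [kaehlerExteriorDerivative_smul, hω, smul_zero, add_zero]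

end Wedge

/-! ### The closed one-form `b^{p-1} db` -/

section CartierForm

variable (p : ℕ) [hp : Fact p.Prime] (K : Type u) [CommRing K] [CharP K p]

/-- The one-form `cartierForm b = b^{p-1} • D b` ("`d(b^p)/p`"), the value of the inverse Cartier operator on
`db`. [cite: GilleSzamuely2017, Lemma 9.2.1] -/
def cartierForm (b : K) : Ω[K⁄ℤ] := b ^ (p - 1) • D ℤ K b

omit hp [CharP K p] in
/-- `cartierForm 0 = 0`. [folklore] -/
@[simp] theorem cartierForm_zero : cartierForm p K 0 = 0 := by
  rw [cartierForm, map_zero, smul_zero]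

omit hp [CharP K p] in
/-- `cartierForm b` is closed: `d(b^{p-1} db) = (p-1) b^{p-2} db ∧ db = 0`. [folklore] -/
theorem extD_ι_cartierForm (b : K) : extD ℤ K (ι K (cartierForm p K b)) = 0 := by
  rw [cartierForm, extD_ι_smul_D, (D ℤ K).leibniz_pow, map_nsmul, map_smul, smul_mul_assoc, smul_mul_assoc,
    ExteriorAlgebra.ι_sq_zero, smul_zero, smul_zero]

omit [CharP K p] in
/-- The Leibniz rule for `cartierForm`: `(ab)^{p-1} d(ab) = a^p • b^{p-1} db + b^p • a^{p-1} da`. [folklore] -/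
theorem cartierForm_mul (a b : K) :
    cartierForm p K (a * b) = a ^ p • cartierForm p K b + b ^ p • cartierForm p K a := by
  have h1 : p - 1 + 1 = p := Nat.sub_add_cancel hp.out.one_le
  have ha : a ^ p = a ^ (p - 1) * a := by rw [← pow_succ, h1]
  have hb : b ^ p = b ^ (p - 1) * b := by rw [← pow_succ, h1]
  rw [cartierForm, cartierForm, cartierForm, Derivation.leibniz, smul_add, smul_smul, smul_smul, smul_smul,
    smul_smul, mul_pow, ha, hb]
  congr 2 <;> ring

end CartierForm

end Literature.NumberTheory.GaloisCohomology

end
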